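/-
Copyright (c) 2026 the pub-hodgecm-mathlib formalisation cell (harness21).  Prover seat hodgecm-mathlib-LH10-p01 (g10): road M6 «ROW 2 ★ DYADIC TWIN» (LEAD F0P3a-plan T14-66),
dealer LH4-plan (g8) WORD #58 (iv) ∕ #60 (ii) «F4-ROW-ODD ∕ R1» = the MODEL-FREE twin of ★ `DepthZeroKappaTransferTypeTwoRowTwoPlace.ncard_selfDual_cyclic_typeTwo_eq_ite` (A-p19 (g26))
at ANY residue characteristic, over ★ p852850 (this seat, the `_of_model_wildOdd` head) + ★ α1 (LH4-p01 (g9)) + ★ B-p08; 2026-09-02.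
-/
import Literature.NumberTheory.Rogawski1990.DepthZeroKappaTransferTypeTwoRowTwoPlaceWildOdd   -- ★ p852850 (this seat) F4-head-odd: `ncard_selfDual_cyclic_typeTwo_eq_ite_of_model_wildOdd` (brings ★ p852817, ★ p852827, ★ p852835, ★ Q3/QM, the inert dictionary)
import Literature.NumberTheory.LocalFields.InertPlaceSkewDiscriminantRootUniform            -- ★ α1 (LH4-p01 (g9)) F4-d′: `exists_skew_sqrt_discriminant_uniformiser` (★ (D2-α)'s conclusion without `|2| = 1`)
import Literature.NumberTheory.NumberFields.RamifiedQuadraticDictionaryWild                  -- ★ B-p08: `exists_isSquare_inv_mul_coe_of_ne_zero` (★ Q3 at ANY place)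
import HarnessLib

/-!
# The depth-zero κ-transfer, type (2): ROW 2 at ONE PLACE, uniformiser frame, ANY residue characteristic (`p = 2` allowed) — MODEL-FREE

Topic `NumberTheory/Rogawski1990`; namespace `Literature.NumberTheory.Rogawski1990`.  ONE THEOREM (no definition, no instance, no notation, no named fact, no `sorry`); kernel lane
`--supports stmt-HodgeConjecture-24833`.  Cell `pub/hodgecm-mathlib` (D-0151), crux H413; road M6 «ROW 2 ★ DYADIC TWIN» (LEAD F0P3a-plan (g15) T14-66), dealer LH4-plan (g8)
WORD #58 (iv) ∕ #60 (ii) (★ files stay byte-frozen, so this is a NEW file rather than an edition of ★ p852850): **F4-ROW-ODD ∕ R1** = ★ tame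
`DepthZeroKappaTransferTypeTwoRowTwoPlace.ncard_selfDual_cyclic_typeTwo_eq_ite` (:244; inert place AWAY FROM 2, binder `hv2`) with `hv2` DELETED, `{e} (he : |2|_v = exp(−e))`
(PARAMETER, `e = 0` tame) and `(hχ1 : |1 − t + D|_w < 1)` ADDED, the ODD-ORDER binder `hdisc : |t² − 4D|_w = exp(−(2N+1))` KEPT (the W-ODD row at a dyadic place; the tame row at
the others), `hNn : 1 ≤ N − e + n`, VALUE `(q+1)·q^{N−e+n−1}`; counted set and parity test VERBATIM.  Its two `|2| = 1` inputs are swapped for ★ α1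
`LocalFields.exists_skew_sqrt_discriminant_uniformiser` (LH4-p01 (g9): the skew square root `y` of the eigen-discriminant, the uniformiser `k₀` of `L⁺_v`, `σy = −yσD`,
`|y| = exp(−N)` — explicit Hilbert 90, no «norm-one unit is a square») and ★ B-p08 `NumberFields.exists_isSquare_inv_mul_coe_of_ne_zero` (a global `m ∈ L` in the local
square class of `ι k₀` at ANY place — Hensel at `|4|`) + ★ Q3's odd-valuation rider `exists_valued_eq_exp_odd_of_isSquare_inv_mul`; then ★ QM (`M = L(√m)`) and the value
from ★ `ncard_selfDual_cyclic_typeTwo_eq_ite_of_model_wildOdd` (p852850).  KILL discipline (T14-57∕66): no hypothesis excluding `p = 2`.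
HONEST LABEL: HC_CM is proved only modulo the 7 printed citations (2 remaining named inputs: hLiu418 = stmt-HodgeConjecture-24832, h413 = stmt-HodgeConjecture-24833) until rung 0 closes;
unconditional local algebra, count-neutral ((D-UNR)∕(D-RAM) PRINT; pays no organ, opens no road; zero label movement until F5 ★ + a desk-priced rider).

* **`ncard_selfDual_cyclic_typeTwo_eq_ite_wildOdd`** — F4-ROW-ODD ∕ R1, the model-free one-place value at any residue characteristic.

## References
* [Rogawski1990] J. D. Rogawski, *Automorphic Representations of Unitary Groups in Three Variables* (1990): §4.9 Lemma 4.9.3 p. 56, Prop. 4.9.1 (b) p. 55.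
* [Kottwitz1986] R. E. Kottwitz, *Base change for unit elements of Hecke algebras*, Compositio Math. 60 (1986): §3.
* [Jacobowitz1962] R. Jacobowitz, *Hermitian forms over local fields*, Amer. J. Math. 84 (1962): §5, §7.
-/

set_option autoImplicit false

noncomputable section

open NumberField IsDedekindDomain Matrix Polynomial Finset
open scoped MatrixGroups WithZero ValuativeRel

namespace Literature.NumberTheory.Rogawski1990

open ValuativeRel
open Literature.NumberTheory.Automorphic Literature.NumberTheory.Automorphic.UnitaryGroup

open Literature.NumberTheory.GaloisRepresentations Literature.NumberTheory.NumberFields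

variable (L : Type) [Field L] [NumberField L] [IsCMField L] {v : HeightOneSpectrum (𝓞 ↥(maximalRealSubfield L))}

set_option synthInstance.maxHeartbeats 200000 in
set_option maxHeartbeats 800000 in
/-- **ROW 2 AT ONE PLACE, UNIFORMISER FRAME, ANY RESIDUE CHARACTERISTIC — THE NUMBER OF SELF-DUAL `τ`-CYCLIC LATTICES OF A TYPE-(2) UNITARY `τ` (model-free).**  For `τ` over the
CM completion `E = L_w` at an inert-unramified place `w ∣ v` (`|2|_v = exp(−e)`, dyadic allowed; `J` hyperspecial `σ_w`-hermitian; `χ_τ = (X − u)(X² − tX + D)` with integral coefficients,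
`σu·u = 1`, `DσD = 1`, `σt = tσD`, `u ≡ 1`, `t ≡ 2`, `1 − t + D ≡ 0 (mod 𝔪_w)`, `ord_w(u² − tu + D) = n`, `ord_w(t² − 4D) = 2N + 1` ODD — the W-ODD row — `1 ≤ N − e + n`; a cyclic vector `w₀`
and a rational `u`-eigenvector `x₀`): `#{Λ : Λ = Λ(g) self-dual (g ∈ U(σ_w,J)) ∧ Λ = ⊕ 𝒪 τ^k w} = (q+1)·q^{N−e+n−1}` if `ord_w d₀ + n` is even, `d₀ = ᵗσ(x₀)·J·x₀`, and `0` otherwise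
(`q = N(v)`).  The skew square root of the discriminant and the uniformiser `k₀` come from ★ α1 `exists_skew_sqrt_discriminant_uniformiser` (no `|2| = 1`), the global model `M = L(√m)` of
`L_w(√(ι k₀))` from ★ B-p08 `exists_isSquare_inv_mul_coe_of_ne_zero` + ★ Q3's odd-valuation rider + ★ QM, and the value from ★ `ncard_selfDual_cyclic_typeTwo_eq_ite_of_model_wildOdd`.
Dyadic-safe twin of ★ `ncard_selfDual_cyclic_typeTwo_eq_ite`. [cite: Rogawski1990, §4.9 Lemma 4.9.3 p. 56, Prop. 4.9.1 (b) p. 55] [cite: Kottwitz1986, §3] [cite: Jacobowitz1962, §5, §7] -/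
theorem ncard_selfDual_cyclic_typeTwo_eq_ite_wildOdd (w : PlacesOver L v) (hw : IsCMField.complexConj L • w.1 = w.1)
    (hv : Algebra.IsUnramifiedIn (𝓞 L) v.asIdeal) {e : ℕ} (he : Valued.v (2 : v.adicCompletion ↥(maximalRealSubfield L)) = WithZero.exp (-(e : ℤ)))
    (J : GL (Fin 3) (w.1.adicCompletion L)) (hJ : J ∈ glInt 3 (w.1.adicCompletion L))
    (hJh : ((J : Matrix (Fin 3) (Fin 3) (w.1.adicCompletion L)).map (galAdicCompletionMap (L := L) (IsCMField.complexConj L) hw))ᵀ = J)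
    (τ : Matrix (Fin 3) (Fin 3) (w.1.adicCompletion L))
    (hτU : (τ.map (galAdicCompletionMap (L := L) (IsCMField.complexConj L) hw))ᵀ * (J : Matrix (Fin 3) (Fin 3) (w.1.adicCompletion L)) * τ = J)
    (hint : ∀ i, τ.charpoly.coeff i ∈ 𝒪[w.1.adicCompletion L])
    {u t D : w.1.adicCompletion L} (hχ : τ.charpoly = (X - C u) * (X ^ 2 - C t * X + C D))
    (hσu : galAdicCompletionMap (L := L) (IsCMField.complexConj L) hw u * u = 1)
    (hσD : D * galAdicCompletionMap (L := L) (IsCMField.complexConj L) hw D = 1)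
    (hσt : galAdicCompletionMap (L := L) (IsCMField.complexConj L) hw t = t * galAdicCompletionMap (L := L) (IsCMField.complexConj L) hw D)
    (hu1 : Valued.v (u - 1) < 1) (ht2 : Valued.v (t - 2) < 1) (hχ1 : Valued.v (1 - t + D) < 1)
    {n N : ℕ} (hn : Valued.v (u * u - t * u + D) = WithZero.exp (-(n : ℤ)))
    (hdisc : Valued.v (t ^ 2 - 4 * D) = WithZero.exp (-((2 * N + 1 : ℕ) : ℤ))) (hNn : 1 ≤ N - e + n)
    {w₀ : Fin 3 → w.1.adicCompletion L} (hK : IsUnit (Matrix.of fun i j : Fin 3 => ((τ ^ (j : ℕ)) *ᵥ w₀) i).det)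
    {x₀ : Fin 3 → w.1.adicCompletion L} (hx₀ : τ *ᵥ x₀ = u • x₀) (hx₀0 : x₀ ≠ 0) :
    {Λ : Submodule 𝒪[w.1.adicCompletion L] (Fin 3 → w.1.adicCompletion L) |
        (∃ g ∈ unitaryGroupOfForm (galAdicCompletionMap (L := L) (IsCMField.complexConj L) hw) (J : Matrix (Fin 3) (Fin 3) (w.1.adicCompletion L)),
          Λ = Submodule.span 𝒪[w.1.adicCompletion L] (Set.range ((g : Matrix (Fin 3) (Fin 3) (w.1.adicCompletion L)))ᵀ)) ∧
        ∃ wv : Fin 3 → w.1.adicCompletion L, Λ = Submodule.span 𝒪[w.1.adicCompletion L] (Set.range fun j : Fin 3 => (τ ^ (j : ℕ)) *ᵥ wv)}.ncard =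
      if Even (WithZero.log (Valued.v (∑ k, ∑ i, galAdicCompletionMap (L := L) (IsCMField.complexConj L) hw (x₀ i) *
            (J : Matrix (Fin 3) (Fin 3) (w.1.adicCompletion L)) i k * x₀ k)) + n) then
        (Ideal.absNorm v.asIdeal + 1) * Ideal.absNorm v.asIdeal ^ (N - e + n - 1) else 0 := by
  classical
  -- ★ α1: `t² − 4D = y²·ι k₀`, `k₀` a uniformiser of `L⁺_v`, `σ_w y = −y σ_w D`, `ord_w y = N` (no `|2| = 1`)
  obtain ⟨y, k₀, -, hk₀, hD, hσy, hN⟩ := LocalFields.exists_skew_sqrt_discriminant_uniformiser L v w hw hv hσD hσt hdisc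
  have hdv : Valued.v (toPlace v w k₀) = WithZero.exp (-1 : ℤ) := by
    rw [Liu2021.LemD1IndexedNonVacuityInertCofinite.valued_toPlace_of_isUnramifiedIn L v hv w, hk₀]
  have hd0 : toPlace v w k₀ ≠ 0 := fun h0 => by rw [h0, map_zero] at hdv; exact WithZero.zero_ne_coe hdv
  -- ★ B-p08: a global `m ∈ L` in the square class of `ι k₀` (any residue characteristic), of odd `w`-order (★ Q3 rider); ★ QM: `M = L(√m)` with its involution
  obtain ⟨m, hm0, hsq⟩ := exists_isSquare_inv_mul_coe_of_ne_zero w.1 (d := toPlace v w k₀) hd0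
  obtain ⟨k', hmval⟩ := exists_valued_eq_exp_odd_of_isSquare_inv_mul (-1) (d := toPlace v w k₀)
    (by rw [hdv]; norm_num) hsq ((map_ne_zero_iff _ (algebraMap L (w.1.adicCompletion L)).injective).2 hm0)
  have hnsq : ¬ IsSquare m := not_isSquare_of_not_isSquare_algebraMap m (not_isSquare_of_valued_eq_exp_odd k' hmval)
  haveI : Fact (Irreducible (X ^ 2 - C m : L[X])) := ⟨irreducible_X_sq_sub_C_of_not_isSquare m hnsq⟩
  haveI : NumberField (AdjoinRoot (X ^ 2 - C m : L[X])) := numberField_adjoinRoot m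
  haveI : Algebra.IsQuadraticExtension L (AdjoinRoot (X ^ 2 - C m : L[X])) := isQuadraticExtension_adjoinRoot m
  obtain ⟨c₁, hc₁, -⟩ := exists_algEquiv_root_eq_neg m
  have hδ0 : AdjoinRoot.root (X ^ 2 - C m : L[X]) ≠ 0 := root_X_sq_sub_C_ne_zero m
  have hmδ : algebraMap L (AdjoinRoot (X ^ 2 - C m : L[X])) m = (AdjoinRoot.root (X ^ 2 - C m : L[X])) ^ 2 := (root_X_sq_sub_C_sq m).symm
  obtain ⟨w₁⟩ : Nonempty (PlacesOver (AdjoinRoot (X ^ 2 - C m : L[X])) w.1) := inferInstance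
  have hdm : IsSquare ((toPlace v w k₀)⁻¹ * (m : w.1.adicCompletion L)) := hsq
  exact ncard_selfDual_cyclic_typeTwo_eq_ite_of_model_wildOdd L w hw hv he J hJ hJh τ hτU hint hχ hσu hσD hσt hu1 ht2 hχ1 hn hNn hK hx₀ hx₀0 hk₀ hD hσy hN
    c₁ hc₁ hδ0 hmδ hdm w₁

end Literature.NumberTheory.Rogawski1990

end
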